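import Summits.QuantumFields.YangMills.Theorems.BalabanUVNodesSpineReadingOfRecord13CoPHK
import Literature.MathematicalPhysics.QuantumFieldTheory.Balaban1983to89.Node00.TwoRunSiteComponents

/-!
# THE COMPONENT-WISE FORGIVING DIAL OF THE SPINE READING OF RECORD — `YMDAG.UVSplit.forgiveCompReading₁₃ K₀ c : KeyReading₁₃ N K₀`, the key reading that
# reads every σ-packed key as its component-wise forgiving window (`Node00.forgiveKeyCompSigma`) at the tuple's floor reading `c`; floor `0` is the identity dial
# (so the pinned record `crOfRecord₁₃VAt` is its instance), the step component is kept, and the level window after it changes nothing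

Cell `pub-ymgap`, YM-PLAN Track A (HUMAN RULING D-0062; width push D-0149); seat `pub-ymgap-dag-n20-d` (R134 (a) N20 NE7b s3 = the U5d ∕ `crOfRecord₁₃` lineage) gen 29;
companion of `Thm/BalabanUVNodesSpineReadingOfRecord13CoPHK` (p608328: `KeyReading₁₃ ∕ FloorReading₁₃ ∕ crOfRecord₁₃KAt ∕ classSetK₁₃ ∕ keyReadingId₁₃ ∕ crOfRecord₁₃KAt_id ∕
windowKeyReading₁₃`) and of `Literature/…/Node00/TwoRunSiteComponents` (the component-wise forgiving window `forgiveKeyComp ∕ forgiveKeyCompSigma`).  `--kind definition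
--supports stmt-QuantumFields-20544 --as helper`; COUNT-NEUTRAL.  ASKED BY dag-n20-w2 g3 (pub-ymgap INBOX l.31394, trigger (t4) of that lineage: «when `TwoRunSiteComponents`
(+ its `KeyReading₁₃` value, say `forgiveCompReading₁₃ K₀ c`) LANDS, this seat files the N20-face notes AT `crOfRecord₁₃KAt K₀ (forgiveCompReading₁₃ K₀ c) (badKeyReadingOfCut₁₃ … jc)
sh`»).  WHAT IS HERE: the dial (`forgiveCompReading₁₃`), `forgiveCompReading₁₃_zero` (floor `0` = `keyReadingId₁₃`) and `crOfRecord₁₃KAt_forgive_zero` (= `crOfRecord₁₃VAt`), the step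
component (`forgiveCompReading₁₃_fst`, the `hkr` the birth-level stratifications need), the coarse class set's membership, `windowDial_forgiveDial` (the level window AFTER the
forgiving dial is the forgiving dial) with its class-set ∕ weight corollaries.  The N20 FACE at this dial (what the weight face books = an UN-ABSORBED birth; a floor-saturated
class is never booked; the survival design rule) is dag-n20-w2's `Thm/BalabanUVNodesN20KeyedRelWeightAtForgivingKey` (INTENT-5, pub-ymgap INBOX l.31741) — not restated here.
HONEST FRAMING.  Definitions + bookkeeping; NO estimate; the forgiving window is NOT Bałaban's (1.80) (size-dependent pending window, (i)∕(ii)) — see the Literature header;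
nothing of Bałaban's asserted; NE7 ∕ NE7b ∕ NE7c NOT PRINTED for d = 4 ∕ NOT proved; no `Provisos₁₃CoPH` inhabitant claimed (K0⁷ OPEN); no stub of K3⁷ closed or claimed;
N19 ∕ N20 ∕ N21 ∕ N27 NOT discharged; counts UNMOVED (typed 28∕28 · discharged 5∕27); one finite four-torus programme at fixed `ε` — NOT ℝ⁴, NOT OS, NOT a mass gap, NOT
the Clay problem.  No decl below carries a cite tag.
-/

noncomputable section

open scoped BigOperators
open Finset

namespace YMDAG.UVSplit

open Literature.MathematicalPhysics.QuantumFieldTheory.Balaban1983to89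
open Literature.MathematicalPhysics.QuantumFieldTheory.Balaban1983to89.T4Continuum
open Literature.MathematicalPhysics.QuantumFieldTheory.Balaban1983to89.Node00
open T4MatchingAssembly (classVal)

variable {F : T4Family} {N : ℕ} [NeZero N]

/-! ## §1 The dial -/

/-- **THE COMPONENT-WISE FORGIVING KEY READING** with floor reading `c`: every key reads as its component-wise forgiving window at its own step's floor
(`Node00.forgiveKeyCompSigma`). [bookkeeping] -/
def forgiveCompReading₁₃ (K₀ : ℕ) (c : FloorReading₁₃ N) : KeyReading₁₃ N K₀ := fun F θ hP g₀ os _ x => forgiveKeyCompSigma F (c F θ hP g₀ os) x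

section Dial

variable (K₀ : ℕ) (c : FloorReading₁₃ N) (θ : Stage13HParams F N) (hP : θ.Provisos₁₃CoPH F N) (g₀ : ℕ → ℝ) (os : List (ULoop F))

/-- The dial, unfolded at a tuple. [bookkeeping] -/
theorem forgiveCompReading₁₃_apply (K : ℕ) (x : Σ K, SiteSeqKey F (K₀ + K)) :
    forgiveCompReading₁₃ K₀ c F θ hP g₀ os K x = forgiveKeyCompSigma F (c F θ hP g₀ os) x := rfl

/-- **THE STEP COMPONENT IS KEPT** (the `hkr` of the birth-level stratifications: the dial reads step-`K` keys to step-`K` keys). [bookkeeping] -/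
@[simp] theorem forgiveCompReading₁₃_fst (K : ℕ) (x : Σ K, SiteSeqKey F (K₀ + K)) : (forgiveCompReading₁₃ K₀ c F θ hP g₀ os K x).1 = x.1 := rfl

/-- **FLOOR `0` IS THE IDENTITY DIAL**. [bookkeeping] -/
theorem forgiveCompReading₁₃_zero : forgiveCompReading₁₃ (N := N) K₀ (fun _ _ _ _ _ _ => 0) = keyReadingId₁₃ N K₀ := by
  funext F θ hP g₀ os K x
  exact forgiveKeyCompSigma_zero F x

/-- … so the forgiving reading at floor `0` gives back the pinned record. [bookkeeping] -/
theorem crOfRecord₁₃KAt_forgive_zero (jcut : ℕ → ℕ) (sh : ShellSplit₁₃CoPH N K₀) :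
    crOfRecord₁₃KAt K₀ (forgiveCompReading₁₃ K₀ fun _ _ _ _ _ _ => 0) (badKeyReadingOfCut₁₃ N K₀ jcut) sh = crOfRecord₁₃VAt K₀ jcut sh := by
  rw [forgiveCompReading₁₃_zero, crOfRecord₁₃KAt_id]

/-- Membership in the forgiving reading's class set: the forgiving window of some class of record. [bookkeeping] -/
theorem mem_classSetK₁₃_forgive_iff (cK : ℕ → ℕ) (K : ℕ) (u : Σ K, SiteSeqKey F (K₀ + K)) :
    u ∈ classSetK₁₃ θ K₀ g₀ (fun _ x => forgiveKeyCompSigma F cK x) K ↔ ∃ x ∈ classSet₁₃ θ K₀ g₀ K, forgiveKeyCompSigma F cK x = u := by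
  letI : ∀ Kc, DecidableEq (SiteSeqKey F Kc) := fun _ => Classical.decEq _
  exact Finset.mem_image

end Dial

/-! ## §2 The level window after the forgiving dial changes nothing -/

section WindowAfter

variable (θ : Stage13HParams F N) (hP : θ.Provisos₁₃CoPH F N) (K₀ : ℕ) (g₀ : ℕ → ℝ) (os : List (ULoop F)) (cK : ℕ → ℕ)

/-- The level window composed after the forgiving window (same floors) IS the forgiving window (`Node00.windowKeySigma_forgiveKeyCompSigma`), as dials. [bookkeeping] -/
theorem windowDial_forgiveDial :
    (fun (_ : ℕ) (x : Σ K, SiteSeqKey F (K₀ + K)) => windowKeySigma F cK (forgiveKeyCompSigma F cK x)) =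
      fun (_ : ℕ) (x : Σ K, SiteSeqKey F (K₀ + K)) => forgiveKeyCompSigma F cK x := by
  funext K x
  exact windowKeySigma_forgiveKeyCompSigma F cK x

/-- … hence the composite dial's class set is the forgiving dial's. [bookkeeping] -/
theorem classSetK₁₃_window_forgive :
    classSetK₁₃ θ K₀ g₀ (fun _ x => windowKeySigma F cK (forgiveKeyCompSigma F cK x)) = classSetK₁₃ θ K₀ g₀ (fun _ x => forgiveKeyCompSigma F cK x) := by
  rw [windowDial_forgiveDial K₀ cK]

/-- … and so are its run-A coarse weights. [bookkeeping] -/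
theorem weightAK₁₃_window_forgive :
    weightAK₁₃ θ hP K₀ g₀ os (fun _ x => windowKeySigma F cK (forgiveKeyCompSigma F cK x)) = weightAK₁₃ θ hP K₀ g₀ os (fun _ x => forgiveKeyCompSigma F cK x) := by
  rw [windowDial_forgiveDial K₀ cK]

/-- … and its run-B coarse weights. [bookkeeping] -/
theorem weightBK₁₃_window_forgive :
    weightBK₁₃ θ hP K₀ g₀ os (fun _ x => windowKeySigma F cK (forgiveKeyCompSigma F cK x)) = weightBK₁₃ θ hP K₀ g₀ os (fun _ x => forgiveKeyCompSigma F cK x) := by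
  rw [windowDial_forgiveDial K₀ cK]

end WindowAfter

end YMDAG.UVSplit

end
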